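import Summits.KontsevichZagierPeriods.KontsevichZagierPeriods.Theses.SymplecticScissors
import Literature.NumberTheory.Transcendental.AyoubPeriodSeries
import Literature.NumberTheory.Transcendental.AyoubPeriodSeriesKernel
import Literature.NumberTheory.Transcendental.AyoubPeriodSeriesLocalizing
import Summits.KontsevichZagierPeriods.KontsevichZagierPeriods.Theorems.SymplecticScissorsTypeAGenerationStubRestrCOneAux
import Summits.KontsevichZagierPeriods.KontsevichZagierPeriods.Theorems.SymplecticScissorsTypeAGenerationStubBinGermCalculus
import Mathlib.RingTheory.MvPowerSeries.Rename
import Mathlib.RingTheory.PowerSeries.Binomial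
import Mathlib.Analysis.Analytic.Binomial
import Mathlib.Analysis.SpecialFunctions.Complex.LogBounds

/-!
# `TypeAGeneration` (stmt-KontsevichZagierPeriods-18392), line `Sketch`, stub `stub_binGermValues` —
the two analytic values of a binomial germ

Registered stub `stub_binGermValues` (G3) of the crux `TypeAGeneration` (route SymplecticScissors,
line `Sketch` = card stokes-compiler), on top of
`Literature/NumberTheory/Transcendental/AyoubPeriodSeries.lean` (`AyoubRel.CSeries = ℂ[[z₀, z₁, …]]`,
`AyoubRel.restrC i 1 = (·)|_{zᵢ = 1}`, `AyoubRel.intC = ∫_{[0,1]^∞}`).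

The binomial germ `binGerm[i, α, a] = (1 − zᵢ/α)^a` is Mathlib's `(1 + X)^a`
(`PowerSeries.binomialSeries ℂ a`, coefficients `Ring.choose a n`) rescaled by `X ↦ −α⁻¹ X` and
renamed into the variable `zᵢ`; its coefficients are `C(a, n) (−α⁻¹)ⁿ` on the `zᵢ`-axis and `0`
off it (`g2_coeff_single`, `g2_coeff_of_ne` of the sibling stub file `…StubBinGermCalculus.lean`).
For `‖α‖ > 1`:

* **(a)** the face `zᵢ = 1` is the constant `(1 − α⁻¹)^a` (principal power):
  `Σₙ C(a, n) (−α⁻¹)ⁿ = (1 + (−α⁻¹))^a` is the binomial theorem on the open unit disc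
  (Mathlib `Complex.one_add_cpow_hasFPowerSeriesOnBall_zero`) — `g3_restrC_one_binGerm`;
* **(b)** `∫₀¹ dzᵢ/(zᵢ − α) = Log(1 − α⁻¹)` for the pole germ
  `1/(zᵢ − α) = −α⁻¹ (1 − zᵢ/α)⁻¹ = −Σₙ α^{−(n+1)} zᵢⁿ`: `Σₙ α^{−(n+1)}/(n+1) = −Log(1 − α⁻¹)`
  (Mercator, Mathlib `Complex.hasSum_taylorSeries_neg_log`) — `g3_intC_poleGerm`.

Elementary bookkeeping (folklore); no definition is introduced.
-/

noncomputable section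

-- `Summit.KontsevichZagierPeriods.KontsevichZagierPeriods.…` is the tree's mandated layout (single-conjunct summit).
set_option linter.dupNamespace false

namespace Summit.KontsevichZagierPeriods.KontsevichZagierPeriods.TypeAGenerationLine

open Finsupp MvPowerSeries
open Literature.NumberTheory.Transcendental
open Literature.NumberTheory.Transcendental.AyoubRel

/-- The binomial germ `(1 − zᵢ/α)^a ∈ ℂ[[z]]`. -/
local notation3 "binGerm[" i ", " α ", " a "]" =>
  (MvPowerSeries.rename (⇑(axisEmb i))
    (PowerSeries.rescale (-(α : ℂ)⁻¹) (PowerSeries.binomialSeries ℂ (a : ℂ)) : MvPowerSeries Unit ℂ) :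
    CSeries)

/-! ## Off-axis translates -/

/-- A translate `b + n eᵢ` of a non-zero exponent `b` with `bᵢ = 0` is off the `zᵢ`-axis.
[folklore] -/
theorem g3_add_single_ne_single {i : ℕ} {b : ℕ →₀ ℕ} (hb : b i = 0) (h0 : b ≠ 0) (n m : ℕ) :
    b + single i n ≠ single i m := by
  intro hm
  apply h0
  ext l
  by_cases hl : l = i
  · rw [hl, hb]
    rfl
  · have e := DFunLike.congr_fun hm l
    rw [Finsupp.add_apply, single_apply, single_apply, if_neg (Ne.symm hl), if_neg (Ne.symm hl),
      add_zero] at e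
    rw [e]
    rfl

/-! ## (a) The face `zᵢ = 1`: the binomial theorem at `−α⁻¹` -/

/-- `‖α⁻¹‖ < 1` for `‖α‖ > 1`. [folklore] -/
theorem g3_norm_inv_lt_one {α : ℂ} (hα : 1 < ‖α‖) : ‖α⁻¹‖ < 1 := by
  rw [norm_inv]
  exact inv_lt_one_of_one_lt₀ hα

/-- **Binomial theorem at `w = −α⁻¹`**: `Σₙ C(a, n) (−α⁻¹)ⁿ = (1 − α⁻¹)^a` (principal power) for
`‖α‖ > 1`. [folklore] -/
theorem g3_hasSum_binomial {α : ℂ} (hα : 1 < ‖α‖) (a : ℂ) :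
    HasSum (fun n : ℕ => Ring.choose a n * (-α⁻¹) ^ n) ((1 - α⁻¹) ^ a) := by
  have hy : (-α⁻¹ : ℂ) ∈ Metric.eball (0 : ℂ) 1 := by
    rw [← ENNReal.ofReal_one, Metric.eball_ofReal, Metric.mem_ball, dist_zero_right, norm_neg]
    exact g3_norm_inv_lt_one hα
  have h := (Complex.one_add_cpow_hasFPowerSeriesOnBall_zero (a := a)).hasSum hy
  rw [zero_add, ← sub_eq_add_neg] at h
  have e : (fun n : ℕ => (binomialSeries ℂ a n) fun _ : Fin n => -α⁻¹) =
      fun n : ℕ => Ring.choose a n * (-α⁻¹) ^ n := by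
    funext n
    rw [binomialSeries, FormalMultilinearSeries.ofScalars_apply_eq, smul_eq_mul]
  rw [e] at h
  exact h

/-- **(a) The face `zᵢ = 1` of `(1 − zᵢ/α)^a` is the constant `(1 − α⁻¹)^a`** (`‖α‖ > 1`).
[folklore] -/
theorem g3_restrC_one_binGerm (i : ℕ) {α : ℂ} (hα : 1 < ‖α‖) (a : ℂ) :
    restrC i 1 (binGerm[i, α, a]) = C ((1 - α⁻¹) ^ a) := by
  classical
  refine MvPowerSeries.ext fun b => ?_
  rw [s4_coeff_restrC_one, coeff_C]
  split_ifs with hb h0 h1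
  · subst h0
    simp only [zero_add]
    rw [← (g3_hasSum_binomial hα a).tsum_eq]
    exact tsum_congr fun n => g2_coeff_single i α a n
  · have h0' : ∀ n : ℕ, coeff (b + single i n) (binGerm[i, α, a]) = 0 := fun n =>
      g2_coeff_of_ne i α a fun m => g3_add_single_ne_single hb h0 n m
    simp only [h0', tsum_zero]
  · exfalso
    apply hb
    rw [h1]
    rfl
  · rfl

/-! ## (b) `∫₀¹ dzᵢ/(zᵢ − α) = Log(1 − α⁻¹)` -/

/-- `C(−1, n) = (−1)ⁿ`. [folklore] -/
theorem g3_choose_neg_one (n : ℕ) : Ring.choose (-1 : ℂ) n = (-1) ^ n := by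
  rw [Ring.choose_neg, add_sub_cancel_left, Ring.choose_natCast, Nat.choose_self, Nat.cast_one,
    Units.smul_def, zsmul_eq_mul, mul_one, Int.cast_negOnePow_natCast]

/-- **Mercator at `α⁻¹`**: `Σₙ −α^{−(n+1)}/(n+1) = Log(1 − α⁻¹)` for `‖α‖ > 1`. [folklore] -/
theorem g3_hasSum_log {α : ℂ} (hα : 1 < ‖α‖) :
    HasSum (fun n : ℕ => -(α⁻¹ ^ (n + 1) * ((n : ℂ) + 1)⁻¹)) (Complex.log (1 - α⁻¹)) := by
  -- adapted from `intC_perGerm` (AyoubPeriodSeriesLocalizing.lean)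
  have h := (hasSum_nat_add_iff' 1).mpr (Complex.hasSum_taylorSeries_neg_log (g3_norm_inv_lt_one hα))
  simp only [Finset.range_one, Finset.sum_singleton, pow_zero, Nat.cast_zero, div_zero,
    sub_zero] at h
  simp only [Nat.cast_add, Nat.cast_one, div_eq_mul_inv] at h
  have h' := h.neg
  rw [neg_neg] at h'
  exact h'

/-- **(b) `∫₀¹ dzᵢ/(zᵢ − α) = Log(1 − α⁻¹)`** (`‖α‖ > 1`) for the pole germ
`1/(zᵢ − α) = −α⁻¹ (1 − zᵢ/α)⁻¹`: its coefficients are `−α^{−(n+1)}` on `zᵢⁿ` and `0` off the axis,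
`∫₀¹ zᵢⁿ dzᵢ = (n+1)⁻¹`, and Mercator. [folklore] -/
theorem g3_intC_poleGerm (i : ℕ) {α : ℂ} (hα : 1 < ‖α‖) :
    intC ((-α⁻¹) • binGerm[i, α, (-1 : ℂ)]) = Complex.log (1 - α⁻¹) := by
  -- adapted from `intC_perGerm` (AyoubPeriodSeriesLocalizing.lean)
  rw [intC, ← (g3_hasSum_log hα).tsum_eq]
  set F : CSeries := (-α⁻¹) • binGerm[i, α, (-1 : ℂ)] with hF
  have h2 := Function.Injective.tsum_eq (single_injective i)
    (f := fun a : ℕ →₀ ℕ => coeff a F * ∏ j ∈ a.support, ((a j : ℂ) + 1)⁻¹) (fun a ha => by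
      by_contra hra
      apply ha
      change coeff a F * ∏ j ∈ a.support, ((a j : ℂ) + 1)⁻¹ = 0
      rw [hF, coeff_smul, g2_coeff_of_ne i α (-1) (fun n hn => hra ⟨n, hn.symm⟩), mul_zero,
        zero_mul])
  rw [← h2]
  refine tsum_congr fun n => ?_
  rw [hF, coeff_smul, g2_coeff_single, intWeight_single, g3_choose_neg_one, ← mul_pow,
    neg_mul_neg, one_mul]
  ring

/-! ## Registered form -/

/-- **G3 — the two analytic values of a binomial germ.** For `‖α‖ > 1`: the face `zᵢ = 1` of
`(1 − zᵢ/α)^a` is the constant `(1 − α⁻¹)^a` (principal power; the binomial series converges to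
`(1 + w)^a` on `‖w‖ < 1`, Mathlib `Complex.one_add_cpow_hasFPowerSeriesOnBall_zero`, at
`w = −α⁻¹`), and `∫₀¹ dzᵢ/(zᵢ − α) = Log(1 − α⁻¹)` for the pole germ
`1/(zᵢ − α) = −α⁻¹ (1 − zᵢ/α)⁻¹` (`Complex.hasSum_taylorSeries_neg_log`). [folklore] -/
theorem stub_binGermValues :
    ∀ (i : ℕ) (α : ℂ), 1 < ‖α‖ →
      (∀ a : ℂ, restrC i 1 (binGerm[i, α, a]) = C ((1 - α⁻¹) ^ a)) ∧
      intC ((-α⁻¹) • binGerm[i, α, (-1 : ℂ)]) = Complex.log (1 - α⁻¹) :=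
  fun i _ hα => ⟨fun a => g3_restrC_one_binGerm i hα a, g3_intC_poleGerm i hα⟩

end Summit.KontsevichZagierPeriods.KontsevichZagierPeriods.TypeAGenerationLine
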